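import Summits.HubbardSuperconductivity.HubbardSuperconductivity.Theorems.WeakCouplingBCSKlStairCore
import Literature.MathematicalPhysics.QuantumLattice.KohnLuttingerLindhardMeasurable

/-!
# KL-MARGIN-SCAN reader hubbard-klscan-idea-4 (lens «cascade»), round 11 — TWO-SIDED KERNEL ENCLOSURES
# `⌊floor⌋ ≤ χ₀(q; μ, t′) ≤ ⌈ceiling⌉` of the static Lindhard function by `decide +kernel`, and the CONTAINMENT GATE
# «engine hull ⊇ kernel enclosure ∋ χ₀» (crux idea «kernel-lindhard-enclosure» on `stmt-HubbardSuperconductivity-0158`;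
# supersedes the round-10 core «kernel-lindhard-box», whose FLOOR evaluator it contains verbatim up to the grid unit)

WHAT IS NEW (object, relative to round 10). Round 10 certified kernel FLOORS of `χ₀ = lindhardFunction (squareDispersion 1 t′) μ q`
(Jensen on two-shell cells + the cosine-coordinate Fermi hyperbola on single-straddle cells) and named two missing rungs: R1 a CEILING
and R2 the TIP cells (both Fermi curves `ε_p = μ`, `ε_{p+q} = μ` cross the cell), where the two-shell integrand
`F = 𝟙{occ p ≠ occ (p+q)}/(|ε_p − μ| + |ε_{p+q} − μ|)` (`lindhardIntegrand_eq_ite_inv`) is UNBOUNDED. This file climbs both: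
ONE certificate tree `QB` over a root square `[−X, X]² ⊇ [−π, π)²` is evaluated ONCE by the kernel into a pair
`(floor numerator, ceiling numerator)` (`QB.eval`, shared grid-point records), every leaf carrying BOTH a floor term (round 10's, or `0`)
and a CERTIFIED CEILING term — or the ceiling FAILS (`none`) and the certificate proves nothing upward. Ceiling rules, all integer
fixed point with OUTWARD rounding: (C0) certified same-side cells: `F ≡ 0`; (C1) two-shell cells: the CHORD rule for `1/g` on
`[g_lo, g_hi]` with the corner-mean/interpolation bound on `avg g` (twin of Jensen); (C2) single-straddle cells: the hyperbola
`b = b⋆(a)` again, now MAJORISED — frozen far shell at its cell MINIMUM `V_lo`, slope `S(a) = 2 + 4t′a` at its minimum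
(`S ↦ log(1 + S L/V)/S` is decreasing), Jacobian `1/|sin| ≤ 1/τ` with CHECKED LOWER |sin| hints, crescent extent per `a`-piece from
the monotone `b⋆`, and a rational LOG MAJORANT `log(1+z) ≤ k·⌈log 2⌉ + w(w+6)/(2(2w+3))` (dyadic reduction + the `[2,1]` Padé bound,
whose defect has derivative `z³/((2z+3)²(1+z)) ≥ 0` — §5 `log_le_pade`); three variants (2-D substitution, `b` only, `a` only) and
the CRUDE bound `|cell|/L` (`F ≤ 1/L` when one point is certified at distance `≥ L > 0` from its curve) are all valid, the kernel takes
the minimum; (C3) TIP cells: the new TIP RULE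
  `∫_C dp/(|e₁| + |e₂|) ≤ (2(1 + λ)/v₁) · h · (log(1 + 4U₁L/(J₀h)) + 1)`,
valid when on the cell `|∂_y e₁| ≥ v₁ > 0`, `|∂_y e₂| ≤ λ v₁`, `|e₁| ≤ U₁`, all four partials `≤ L`, and the INTERVAL DETERMINANT
`|det(∇e₁, ∇e₂)| ≥ J₀ > 0` (proof: Fubini; the monotone substitution `u = e₁(x, ·)`; the slice comparison
`|e₁| + |e₂| ≥ (|e₁| + c⋆)/(1 + λ)` (§5 `tip_slice_ineq`); `∫ du/(|u| + c) = log`-form; the mean-value matrix `Ā` of `(e₁, e₂)` on the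
convex cell has entries in the certified ranges, so `|Ā v|₁ ≥ (J₀/L)|v|_∞` and `|e|₁ ≥ (J₀/2L)·|x − x₀|` along the cell; finally
`∫₀^T log(1 + A/t) dt = T log(1 + A/T) + A log(1 + T/A) ≤ T log(1 + A/T) + T`), in four orientations (substitute `x` or `y`, monotone
function `e₁` or `e₂`), with the partials enclosed from SIGNED sine ranges that come for free from the cosine records
(`|sin| = √(1 − cos²)` bracketed by checked hints, sign from the certified monotonicity of `cos`). The `1/J₀` degeneration at a tangency of
the two curves (`q` on the `2k_F` ridge) is real and is met by LOCAL depth only (tips are isolated points: the tree is deep at `≤ 16` spots).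
(C4) the FRAME `[−X, X]² ∖ [−X₀, X₀]²` (`X₀ = 2²³/U < π < X`) is peeled by explicit cuts (`cx/cy`) into four thin strips whose cells
use (C0)/(C2)/crude; floor terms are granted only to cells inside `[−piLoZ, piLoZ)² ⊆ BZ`, so ONE tree serves both directions.

THE GATE (§4). `FloorSoundAt P t` / `CeilSoundAt P t` are the two named analytic statements (predicates, prover-owned; the ceiling
statement also delivers integrability, since a finite certified ceiling bounds the lower Lebesgue integral on a cover of BZ). Proved here from them:
`floor_le_lindhard`, `lindhard_le_ceil`, the two-sided `lindhard_mem_enclosure`, the CONTAINMENT theorem `hull_contains`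
(«engine hull `[lo, hi]` ⊇ kernel enclosure ⇒ `lo ≤ χ₀ ≤ hi` at the point» — the kernel CONFIRMS a hull row at a rational point) and the
two exclusion gates `hull_excluded_below/above` (Bochner dichotomy: no integrability needed to REFUTE a row).

NUMBERS: see the certificate modules appended to this core (witness point of the j320108 retraction and ring-box centres of margin-1's
float-checked samples); every number there is a kernel identity `P.rootEval T = (N_floor, some N_ceil)`; the enclosure in `ℝ` is modulo the
two named Props. HONEST FRAMING. Free-band quadrature only. Floats are floats (only the emitter's targets); nothing here asserts a KL margin at
any `t′ ≠ 0`, `K₃`, `U₀`, the window or superconductivity; a Kohn–Luttinger `O(U²)` channel statement is not ODLRO; nothing in this file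
proves superconductivity in the Hubbard model; no `t′ ≠ 0` statement chains to the summit Statement.
-/

noncomputable section

set_option linter.dupNamespace false

namespace Summit.HubbardSuperconductivity.HubbardSuperconductivity.Theorems.KlLindhardEnclosure

open Real Set MeasureTheory Literature.MathematicalPhysics.QuantumLattice
open Summit.HubbardSuperconductivity.HubbardSuperconductivity.Theorems
open Summit.HubbardSuperconductivity.HubbardSuperconductivity.Theorems.FSPoly (cosTaylorQ cosLoQ cosUpQ piLoQ cosLoQ_le_cos
  cos_le_cosUpQ cast_cosTaylorQ)
open Summit.HubbardSuperconductivity.HubbardSuperconductivity.Theorems.KlStair (bandQ bandR piUpQ cast_bandQ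
  squareDispersion_eq_bandR pi_lt_piUpQ)

/-! ## §1 Rational enclosures of `cos` and fixed-point rounding (as in round 10) -/

/-- Degree-18 Taylor MINORANT of `cos` (odd `M = 9`), used at the shifted abscissae `p + q`. [folklore] -/
def cosLo9 (x : ℚ) : ℚ := cosTaylorQ 9 x

/-- Degree-20 Taylor MAJORANT of `cos` (even `M = 10`), used at the shifted abscissae `p + q`. [folklore] -/
def cosUp10 (x : ℚ) : ℚ := cosTaylorQ 10 x

/-- `cosLo9 x ≤ cos x` for every rational `x`. [folklore] -/
theorem cosLo9_le_cos (x : ℚ) : ((cosLo9 x : ℚ) : ℝ) ≤ Real.cos (x : ℝ) := by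
  rw [cosLo9, cast_cosTaylorQ]
  exact Literature.Computability.MetaComplexity.cosTaylorSum_le_cos (M := 9) (by decide) _

/-- `cos x ≤ cosUp10 x` for every rational `x`. [folklore] -/
theorem cos_le_cosUp10 (x : ℚ) : Real.cos (x : ℝ) ≤ ((cosUp10 x : ℚ) : ℝ) := by
  rw [cosUp10, cast_cosTaylorQ]
  exact Literature.Computability.MetaComplexity.cos_le_cosTaylorSum (M := 10) (by decide) _

/-- The fixed denominator `D = 2^40` of all value numerators. [folklore] -/
def D : ℤ := 2 ^ 40

/-- `⌈D · log 2⌉` (`D log 2 = 762 123 384 785.81…`). [folklore] -/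
def L2UP : ℤ := 762123384786

/-- Round a rational DOWN to an integer numerator over `D`: `flZ x / D ≤ x`. [folklore] -/
def flZ (x : ℚ) : ℤ := Rat.floor (x * 2 ^ 40)

/-- Round a rational UP to an integer numerator over `D`: `x ≤ clZ x / D`. [folklore] -/
def clZ (x : ℚ) : ℤ := -Rat.floor (-x * 2 ^ 40)

/-- `flZ x / D ≤ x`. [folklore] -/
theorem flZ_le (x : ℚ) : ((flZ x : ℤ) : ℚ) / 2 ^ 40 ≤ x := by
  unfold flZ
  rw [div_le_iff₀ (by positivity)]
  exact Rat.floor_le _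

/-- `x ≤ clZ x / D`. [folklore] -/
theorem le_clZ (x : ℚ) : x ≤ ((clZ x : ℤ) : ℚ) / 2 ^ 40 := by
  unfold clZ
  rw [le_div_iff₀ (by positivity)]
  have := Rat.floor_le (-x * 2 ^ 40)
  push_cast; linarith

/-- Floor division by a POSITIVE integer (`Int` division `/` = floor for positive divisors). [folklore] -/
def fdivZ (a b : ℤ) : ℤ := a / b

/-- Ceiling division by a positive integer. [folklore] -/
def cdivZ (a b : ℤ) : ℤ := -((-a) / b)

/-- `fdivZ a b ≤ a/b` over `ℚ` for a positive divisor. [folklore] -/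
theorem fdivZ_le_div (a b : ℤ) (hb : 0 < b) : ((fdivZ a b : ℤ) : ℚ) ≤ (a : ℚ) / (b : ℚ) := by
  unfold fdivZ
  rw [le_div_iff₀ (by exact_mod_cast hb)]
  exact_mod_cast Int.ediv_mul_le a hb.ne'

/-- `a/b ≤ cdivZ a b` over `ℚ` for a positive divisor. [folklore] -/
theorem div_le_cdivZ (a b : ℤ) (hb : 0 < b) : (a : ℚ) / (b : ℚ) ≤ ((cdivZ a b : ℤ) : ℚ) := by
  unfold cdivZ
  rw [div_le_iff₀ (by exact_mod_cast hb)]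
  have h := Int.ediv_mul_le (-a) hb.ne'
  have h' : (((-a) / b : ℤ) : ℚ) * (b : ℚ) ≤ ((-a : ℤ) : ℚ) := by exact_mod_cast h
  push_cast at h' ⊢
  linarith

/-- INTEGER Taylor numerator of the cosine: `cosTaylorZ M z U = U^{2M} (2M)! · T_M(z/U)` (so the kernel never touches `ℚ`:
`T_{M+1}`-numerator `= T_M`-numerator `· U² (2M+1)(2M+2) + (−1)^{M+1} z^{2M+2}`). [folklore] -/
def cosTaylorZ : ℕ → ℤ → ℤ → ℤ
  | 0, _, _ => 1
  | M + 1, z, U => cosTaylorZ M z U * (U ^ 2 * (((2 * M + 1) * (2 * M + 2) : ℕ) : ℤ)) + (-1) ^ (M + 1) * z ^ (2 * (M + 1))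

/-- Its denominator `U^{2M} (2M)!`. [folklore] -/
def cosDenZ (M : ℕ) (U : ℤ) : ℤ := U ^ (2 * M) * (((2 * M).factorial : ℕ) : ℤ)

/-- `cosDenZ M U > 0` for `U > 0`. [folklore] -/
theorem cosDenZ_pos (M : ℕ) {U : ℤ} (hU : 0 < U) : 0 < cosDenZ M U := by
  unfold cosDenZ
  exact mul_pos (pow_pos hU _) (by exact_mod_cast Nat.factorial_pos _)

/-- The integer numerator IS the rational Taylor polynomial: `T_M(z/U) = cosTaylorZ M z U / cosDenZ M U`. [folklore] -/
theorem cosTaylorQ_eq_div (M : ℕ) (z U : ℤ) (hU : U ≠ 0) :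
    cosTaylorQ M ((z : ℚ) / (U : ℚ)) = (cosTaylorZ M z U : ℚ) / (cosDenZ M U : ℚ) := by
  have hUq : (U : ℚ) ≠ 0 := by exact_mod_cast hU
  induction M with
  | zero => simp [cosTaylorQ, cosTaylorZ, cosDenZ]
  | succ M ih =>
    rw [cosTaylorQ, ih]
    have hf : (((2 * (M + 1)).factorial : ℕ) : ℚ) = (2 * (M : ℚ) + 2) * (2 * (M : ℚ) + 1) * (((2 * M).factorial : ℕ) : ℚ) := by
      rw [show 2 * (M + 1) = (2 * M + 1) + 1 by ring, Nat.factorial_succ, Nat.factorial_succ]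
      push_cast
      ring
    have hfac : (((2 * M).factorial : ℕ) : ℚ) ≠ 0 := by exact_mod_cast (Nat.factorial_pos _).ne'
    have hD0 : (cosDenZ M U : ℚ) = (U : ℚ) ^ (2 * M) * (((2 * M).factorial : ℕ) : ℚ) := by
      simp only [cosDenZ]
      push_cast
      rfl
    have hD1 : (cosDenZ (M + 1) U : ℚ) = (U : ℚ) ^ (2 * M) * (((2 * M).factorial : ℕ) : ℚ) * ((U : ℚ) ^ 2 * ((2 * (M : ℚ) + 1) * (2 * (M : ℚ) + 2))) := by
      simp only [cosDenZ]
      push_cast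
      rw [hf]
      ring
    have hZ1 : (cosTaylorZ (M + 1) z U : ℚ) = (cosTaylorZ M z U : ℚ) * ((U : ℚ) ^ 2 * ((2 * (M : ℚ) + 1) * (2 * (M : ℚ) + 2))) + (-1) ^ (M + 1) * (z : ℚ) ^ (2 * (M + 1)) := by
      simp only [cosTaylorZ]
      push_cast
      ring
    rw [hD0, hD1, hZ1, hf]
    have hU2 : (U : ℚ) ^ (2 * M) ≠ 0 := pow_ne_zero _ hUq
    have h21 : (2 * (M : ℚ) + 1) ≠ 0 := by positivity
    have h22 : (2 * (M : ℚ) + 2) ≠ 0 := by positivity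
    rw [div_pow, show ((U : ℚ)) ^ (2 * (M + 1)) = (U : ℚ) ^ (2 * M) * (U : ℚ) ^ 2 by ring]
    field_simp

/-- Fixed-point FLOOR of `D · T_M(z/U)` computed in integers: `⌊2^40 · cosTaylorZ / cosDenZ⌋`. [folklore] -/
def cosFlZ (M : ℕ) (z U : ℤ) : ℤ := fdivZ (cosTaylorZ M z U * 2 ^ 40) (cosDenZ M U)

/-- Fixed-point CEILING of `D · T_M(z/U)` computed in integers. [folklore] -/
def cosClZ (M : ℕ) (z U : ℤ) : ℤ := cdivZ (cosTaylorZ M z U * 2 ^ 40) (cosDenZ M U)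

/-- `cosFlZ M z U / D ≤ cos (z/U)` for odd `M` and `U > 0` (integer floor ≤ rational Taylor minorant ≤ cos). [folklore] -/
theorem cosFlZ_le_cos {M : ℕ} (hM : Odd M) (z U : ℤ) (hU : 0 < U) :
    ((cosFlZ M z U : ℤ) : ℝ) / 2 ^ 40 ≤ Real.cos ((z : ℝ) / (U : ℝ)) := by
  have h1 : ((cosFlZ M z U : ℤ) : ℚ) / 2 ^ 40 ≤ cosTaylorQ M ((z : ℚ) / (U : ℚ)) := by
    rw [div_le_iff₀ (by positivity), cosTaylorQ_eq_div M z U hU.ne', div_mul_eq_mul_div]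
    have h := fdivZ_le_div (cosTaylorZ M z U * 2 ^ 40) (cosDenZ M U) (cosDenZ_pos M hU)
    unfold cosFlZ
    push_cast at h ⊢
    exact h
  have h2 : ((cosTaylorQ M ((z : ℚ) / (U : ℚ)) : ℚ) : ℝ) ≤ Real.cos ((z : ℝ) / (U : ℝ)) := by
    have h := Literature.Computability.MetaComplexity.cosTaylorSum_le_cos hM ((((z : ℚ) / (U : ℚ) : ℚ) : ℝ))
    rw [← cast_cosTaylorQ] at h
    simpa [Rat.cast_div] using h
  have h1' : (((cosFlZ M z U : ℤ) : ℝ)) / 2 ^ 40 ≤ ((cosTaylorQ M ((z : ℚ) / (U : ℚ)) : ℚ) : ℝ) := by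
    have := (Rat.cast_le (K := ℝ)).mpr h1
    simpa [Rat.cast_div, Rat.cast_pow] using this
  exact h1'.trans h2

/-- `cos (z/U) ≤ cosClZ M z U / D` for even `M` and `U > 0`. [folklore] -/
theorem cos_le_cosClZ {M : ℕ} (hM : Even M) (z U : ℤ) (hU : 0 < U) :
    Real.cos ((z : ℝ) / (U : ℝ)) ≤ ((cosClZ M z U : ℤ) : ℝ) / 2 ^ 40 := by
  have h1 : cosTaylorQ M ((z : ℚ) / (U : ℚ)) ≤ ((cosClZ M z U : ℤ) : ℚ) / 2 ^ 40 := by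
    rw [le_div_iff₀ (by positivity), cosTaylorQ_eq_div M z U hU.ne', div_mul_eq_mul_div]
    have h := div_le_cdivZ (cosTaylorZ M z U * 2 ^ 40) (cosDenZ M U) (cosDenZ_pos M hU)
    unfold cosClZ
    push_cast at h ⊢
    exact h
  have h2 : Real.cos ((z : ℝ) / (U : ℝ)) ≤ ((cosTaylorQ M ((z : ℚ) / (U : ℚ)) : ℚ) : ℝ) := by
    have h := Literature.Computability.MetaComplexity.cos_le_cosTaylorSum hM ((((z : ℚ) / (U : ℚ) : ℚ) : ℝ))
    rw [← cast_cosTaylorQ] at h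
    simpa [Rat.cast_div] using h
  have h1' : ((cosTaylorQ M ((z : ℚ) / (U : ℚ)) : ℚ) : ℝ) ≤ (((cosClZ M z U : ℤ) : ℝ)) / 2 ^ 40 := by
    have := (Rat.cast_le (K := ℝ)).mpr h1
    simpa [Rat.cast_div, Rat.cast_pow] using this
  exact h2.trans h1'

/-- `⌊log₂ n⌋` by structural halving (`fuel` bounds the recursion; `ilog2 fuel n = ⌊log₂ n⌋` whenever `n < 2^fuel`). [folklore] -/
def ilog2 : ℕ → ℕ → ℕ
  | 0, _ => 0
  | fuel + 1, n => if n < 2 then 0 else ilog2 fuel (n / 2) + 1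

/-- LOG MAJORANT, numerators over `D`: for `Z ≥ 0`, `D · log(1 + Z/D) ≤ logUpZ Z`. Dyadic reduction `1 + z = 2^k (1 + w)`, `w ∈ [0, 1]`
(`k = ⌊log₂((D+Z)/D)⌋`, `w` rounded UP), then `log 2 ≤ L2UP/D` and the Padé majorant `log(1+w) ≤ w(w+6)/(2(2w+3))` (§5). [folklore] -/
def logUpZ (Z : ℤ) : ℤ :=
  let n := D + Z
  let k : ℕ := ilog2 128 (n.toNat / D.toNat)
  let w := cdivZ n (2 ^ k) - D
  (k : ℤ) * L2UP + cdivZ (w * (w + 6 * D)) (2 * (2 * w + 3 * D))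

/-- LOG MINORANT (round 10), numerators over `D`: `logLoZ Z ≤ D log(1 + Z/D)`, `2z/(2+z) ≤ log(1+z)`. [folklore] -/
def logLoZ (Z : ℤ) : ℤ := fdivZ (2 * Z * D) (2 * D + Z)

end Summit.HubbardSuperconductivity.HubbardSuperconductivity.Theorems.KlLindhardEnclosure

end
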